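import Summits.QuantumFields.GaugeBoot.GaugeAveragedDensity
import Summits.QuantumFields.GaugeBoot.DiagonalRPTorusTwoGaugeInvariantMaster
import HarnessLib

/-!
# Reflection cuts on GAUGE-INVARIANT data (Wilson loops): consistent with the torus bootstrap IFF
# the Wilson measure is reflection positive on gauge-invariant observables (gauge-boot, L3 ↔ L1)

HONEST FRAMING (cell `pub-gaugeboot`, page 1 of every file): the venture produces certified bounds
on lattice expectations at stated coupling, gauge group, dimension and torus size; NOT a mass gap,
NOT a continuum limit, NOT a string tension; NOT Yang–Mills-summit-bearing (barriers
`FixedCouplingUltralocality`, `PerturbativeInvisibility`). Structural; it certifies no number.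
It says which positivity constraints a TORUS bootstrap on Wilson-loop data may impose.

## Content

`BootstrapReflectionCutConsistency` proved: a reflection cut family `(Θ, S)` on ALL `S`-supported
test functions is consistent with the `SU(N)` torus bootstrap iff the Wilson measure is RP for
`(Θ, S)`. A Kazakov–Zheng bootstrap only has GAUGE-INVARIANT test functions (Wilson loops; the
cell's `diagRpLevelValuesSuN`). With the gauge-averaged density theorem `giRp_of_giPoly_rp`
(`GaugeAveragedDensity`) the same dichotomy holds for the gauge-invariant cut family, against
reflection positivity ON GAUGE-INVARIANT OBSERVABLES — which can differ from plain RP (the even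
two-torus "gauge artefact" of the cell's L3: `DiagRPTwo.even_torus_gauge_artefact_suN`):

* `GIReflectionPositiveOn μ Θ S` — `0 ≤ ∫ (F∘Θ)‾ F dμ` for gauge-invariant bounded measurable
  complex `F` with `DependsOn F S`; `ReflectionPositiveOn.gi`; ★★ `giReflectionPositiveOn_iff_poly`
  (decided by gauge-invariant polynomials; `μ` gauge invariant, `Θ` a `μ`-preserving involution);
* `giRpCutLevelValuesSuN N β Θ S n P` — the level-`n` feasible values with the cuts
  `0 ≤ φ ((v∘Θ) · v)` for GAUGE-INVARIANT `S`-supported level-`n` test functions; the cell's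
  `diagRpLevelValuesSuN` is literally the diagonal instance (`diagRpLevelValuesSuN_eq`);
* ★★★ `giRpCut_of_bootstrap_suN`, `wilson_mem_giRpCutLevelValues_suN`, `giRpCutLevelValues_subset_Icc_suN`
  (GI-RP ⇒ every solution satisfies the cuts; sound convergent relaxation);
  ★★★ `giRpCutLevelValues_eventually_eq_empty_suN`, `exists_giRpCut_neg_of_bootstrap_suN` (not GI-RP
  ⇒ eventually infeasible, every solution violates a gauge-invariant cut);
  ★★★ `giRpCuts_sound_iff_suN`, `giRpCuts_dichotomy_suN`;
* the DIAGONAL family on Wilson-loop data: `giReflectionPositiveOn_configDiagSwap_iff`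
  (`= GaugeInvariantDiagonalRP`), ★★★ `giDiagCuts_sound_iff_suN` (any torus, any `β`: the cell's
  gauge-invariant diagonal cuts are consistent IFF `GaugeInvariantDiagonalRP`), and the completed
  two-dimensional table ★★★ `giDiagCuts_two_iff_suN` (`(ℤ/L)²`, `L ≥ 2`, `L ≠ 3`, `N ≥ 2`: consistent
  iff `(Even L ∧ 4 ≤ L) ∨ (Odd L ∧ 0 ≤ β)` — so on ODD two-tori at `β < 0` the gauge-invariant
  diagonal cuts are eventually infeasible, `giDiagCuts_two_odd_neg_eventually_eq_empty_suN`).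

References: V. Kazakov, Z. Zheng, arXiv:2203.11360 §3.1, §4; K. Osterwalder, E. Seiler, Ann.
Phys. 110 (1978) 440 §2. Folklore-level; not in print as theorems as far as the cell's searches go.
-/

noncomputable section

open MeasureTheory Filter Topology NormedSpace
open scoped ComplexOrder ComplexConjugate
open Literature.MathematicalPhysics.QuantumFieldTheory (LatticeRep Site Edge GaugeConfig gaugeTransform
  IsGaugeInvariant wilsonAction wilsonMeasure wilsonExpectation isProbabilityMeasure_wilsonMeasure
  wilsonMeasure_map_gaugeTransform_holds)

namespace Summit.QuantumFields.GaugeBoot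

/-! ## Reflection positivity on gauge-invariant observables -/

section Generic

variable {d L : ℕ} {G : Type*}

/-- **Reflection positivity of `μ` for `(Θ, S)` ON GAUGE-INVARIANT OBSERVABLES**:
`0 ≤ ∫ conj (F (Θ U)) · F U dμ` for every gauge-invariant bounded measurable complex `F` with
`DependsOn F S` (the shape of the cell's `GaugeInvariantDiagonalRP`). [shape] A parametric
definition of a proposition — NOT a fact. [folklore] -/
def GIReflectionPositiveOn [Group G] [MeasurableSpace G] (μ : Measure (GaugeConfig d L G))
    (Θ : GaugeConfig d L G → GaugeConfig d L G) (S : Set (Edge d L)) : Prop :=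
  ∀ F : GaugeConfig d L G → ℂ, Measurable F → (∃ C : ℝ, ∀ U, ‖F U‖ ≤ C) → IsGaugeInvariant F →
    DependsOn F S → 0 ≤ ∫ U, conj (F (Θ U)) * F U ∂μ

variable [NeZero L] [Group G] [TopologicalSpace G] [IsTopologicalGroup G] [CompactSpace G] [T2Space G]
  [SecondCountableTopology G] [MeasurableSpace G] [BorelSpace G]

omit [NeZero L] [TopologicalSpace G] [IsTopologicalGroup G] [CompactSpace G] [T2Space G]
  [SecondCountableTopology G] [BorelSpace G] in
/-- Plain RP implies RP on gauge-invariant observables. -/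
theorem ReflectionPositiveOn.gi {μ : Measure (GaugeConfig d L G)} {Θ : GaugeConfig d L G → GaugeConfig d L G}
    {S : Set (Edge d L)} (h : ReflectionPositiveOn μ Θ S) : GIReflectionPositiveOn μ Θ S :=
  fun F hF hFb _ hFS => h F hF hFb hFS

omit [IsTopologicalGroup G] [T2Space G] in
/-- **Real form**: `0 ≤ ∫ f (Θ U) · f U dμ` for every continuous real gauge-invariant `f` with
`DependsOn f S`. -/
theorem GIReflectionPositiveOn.real {μ : Measure (GaugeConfig d L G)}
    {Θ : GaugeConfig d L G → GaugeConfig d L G} {S : Set (Edge d L)} (h : GIReflectionPositiveOn μ Θ S)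
    (f : C(GaugeConfig d L G, ℝ)) (hfG : IsGaugeInvariant (⇑f)) (hfS : DependsOn (⇑f) S) :
    0 ≤ ∫ U, f (Θ U) * f U ∂μ := by
  have h' := h (fun U => (f U : ℂ)) (Complex.continuous_ofReal.comp f.continuous).measurable
    ⟨‖f‖, fun U => by simpa using f.norm_coe_le_norm U⟩ (fun g U => by simp only [hfG g U])
    (fun U V hUV => by simp only [hfS hUV])
  simp only [Complex.conj_ofReal, ← Complex.ofReal_mul] at h'
  rw [integral_complex_ofReal] at h'
  exact_mod_cast h'

variable (r : LatticeRep G)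

/-- ★★ **RP on gauge-invariant observables is decided by gauge-invariant POLYNOMIAL observables**
(`μ` a gauge-invariant probability measure preserved by the involution `Θ`; `giRp_of_giPoly_rp`).
[folklore] -/
theorem giReflectionPositiveOn_iff_poly (μ : Measure (GaugeConfig d L G)) [IsProbabilityMeasure μ]
    (hμ : ∀ g : Site d L → G, μ.map (gaugeTransform g) = μ)
    {Θ : GaugeConfig d L G → GaugeConfig d L G} (hΘ : MeasurePreserving Θ μ μ)
    (hΘΘ : ∀ U, Θ (Θ U) = U) (S : Set (Edge d L)) :
    GIReflectionPositiveOn μ Θ S ↔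
      ∀ p ∈ polyAlgebra (ι := Edge d L) r, IsGaugeInvariant (⇑p) → DependsOn (⇑p) S →
        0 ≤ ∫ U, p (Θ U) * p U ∂μ :=
  ⟨fun h p _ hpG hpS => h.real p hpG hpS,
    fun h _ hF hFb hFG hFS => giRp_of_giPoly_rp r μ hμ hΘ hΘΘ S h hF hFb hFG hFS⟩

/-- **A failure of RP on gauge-invariant observables has a gauge-invariant POLYNOMIAL witness.** -/
theorem exists_giPoly_neg_of_not_giReflectionPositiveOn (μ : Measure (GaugeConfig d L G))
    [IsProbabilityMeasure μ] (hμ : ∀ g : Site d L → G, μ.map (gaugeTransform g) = μ)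
    {Θ : GaugeConfig d L G → GaugeConfig d L G} (hΘ : MeasurePreserving Θ μ μ) (hΘΘ : ∀ U, Θ (Θ U) = U)
    {S : Set (Edge d L)} (h : ¬ GIReflectionPositiveOn μ Θ S) :
    ∃ p ∈ polyAlgebra (ι := Edge d L) r, IsGaugeInvariant (⇑p) ∧ DependsOn (⇑p) S ∧
      ∫ U, p (Θ U) * p U ∂μ < 0 := by
  rw [giReflectionPositiveOn_iff_poly r μ hμ hΘ hΘΘ S] at h
  push Not at h
  obtain ⟨p, hp, hpG, hpS, hneg⟩ := h
  exact ⟨p, hp, hpG, hpS, hneg⟩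

omit [T2Space G] [SecondCountableTopology G] in
/-- **The cell's `GaugeInvariantDiagonalRP r.ρ β i j` is `GIReflectionPositiveOn` for the diagonal
swap and the closed diagonal half.** -/
theorem giReflectionPositiveOn_configDiagSwap_iff {N : ℕ} (ρ : G →* Matrix (Fin N) (Fin N) ℂ)
    (β : ℝ) (i j : Fin d) :
    GIReflectionPositiveOn (wilsonMeasure (d := d) (L := L) ρ β) (configDiagSwap i j)
        (diagHalfLinks (L := L) i j) ↔ GaugeInvariantDiagonalRP (d := d) (L := L) ρ β i j :=
  ⟨fun h F hF hFb hFH hFG => h F hF hFb hFG ((isDiagonalHalfObservable_iff_dependsOn i j F).1 hFH),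
    fun h F hF hFb hFG hFS => h F hF hFb ((isDiagonalHalfObservable_iff_dependsOn i j F).2 hFS) hFG⟩

end Generic

/-! ## The gauge-invariant cut family of the `SU(N)` bootstrap attached to `(Θ, S)` -/

section Unitary

open Literature.MathematicalPhysics.QuantumLattice

variable {d L : ℕ} [NeZero L] (N : ℕ) (β : ℝ)

/-- **The level-`n` feasible values of `P` with the gauge-invariant `(Θ, S)`-cuts**: word-level-`n`
`SU(N)` bootstrap feasibility and `0 ≤ φ ((v ∘ Θ) · v)` for every level-`n` test function `v`
supported in `S` which is GAUGE INVARIANT. [folklore] -/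
def giRpCutLevelValuesSuN
    (Θ : C(GaugeConfig d L (Matrix.specialUnitaryGroup (Fin N) ℂ),
      GaugeConfig d L (Matrix.specialUnitaryGroup (Fin N) ℂ)))
    (S : Set (Edge d L)) (n : ℕ) (P : C(GaugeConfig d L (Matrix.specialUnitaryGroup (Fin N) ℂ), ℝ)) :
    Set ℝ :=
  {t | ∃ φ : C(GaugeConfig d L (Matrix.specialUnitaryGroup (Fin N) ℂ), ℝ) →ₗ[ℝ] ℝ,
    IsBootstrapFeasible (fundamentalLatticeRep N) (suExp N)
        (fun _ => wilsonAction (fundamentalRep (Fin N))) β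
        (wordTruncation (ι := Edge d L) (fundamentalLatticeRep N) n) φ ∧
      (∀ v ∈ wordTruncation (ι := Edge d L) (fundamentalLatticeRep N) n,
        DependsOn (⇑v) S → IsGaugeInvariant (⇑v) → 0 ≤ φ (v.comp Θ * v)) ∧
      φ P = t}

variable {N β}
variable {Θ : C(GaugeConfig d L (Matrix.specialUnitaryGroup (Fin N) ℂ),
  GaugeConfig d L (Matrix.specialUnitaryGroup (Fin N) ℂ))} {S : Set (Edge d L)}

/-- The cell's gauge-invariant DIAGONAL feasible values `diagRpLevelValuesSuN` are the instance
`Θ = Θ_{ij}`, `S = diagHalfLinks i j`. -/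
theorem diagRpLevelValuesSuN_eq (i j : Fin d) (n : ℕ)
    (P : C(GaugeConfig d L (Matrix.specialUnitaryGroup (Fin N) ℂ), ℝ)) :
    diagRpLevelValuesSuN (d := d) (L := L) N β i j n P =
      giRpCutLevelValuesSuN N β (diagSwapCM i j) (diagHalfLinks (L := L) i j) n P := by
  ext t
  simp only [diagRpLevelValuesSuN, giRpCutLevelValuesSuN, Set.mem_setOf_eq, isDiagonalHalfObservable_iff_dependsOn]

/-- Fewer cuts than the plain family: the plain feasible values are gauge-invariant-cut feasible
values. -/
theorem rpCutLevelValues_subset_giRpCutLevelValues (n : ℕ)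
    (P : C(GaugeConfig d L (Matrix.specialUnitaryGroup (Fin N) ℂ), ℝ)) :
    rpCutLevelValuesSuN N β Θ S n P ⊆ giRpCutLevelValuesSuN N β Θ S n P := by
  rintro t ⟨φ, hφ, hcut, rfl⟩
  exact ⟨φ, hφ, fun v hv hvS _ => hcut v hv hvS, rfl⟩

/-- More cuts than none. -/
theorem giRpCutLevelValues_subset_levelValues (n : ℕ)
    (P : C(GaugeConfig d L (Matrix.specialUnitaryGroup (Fin N) ℂ), ℝ)) :
    giRpCutLevelValuesSuN N β Θ S n P ⊆ levelValuesSuN (d := d) (L := L) N β n P := by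
  rintro t ⟨φ, hφ, -, rfl⟩
  exact ⟨φ, hφ, rfl⟩

/-- ★★ **Convergence** of the gauge-invariant cut SDP bounds to the Wilson value. [folklore] -/
theorem giRpCutLevelValues_subset_Icc_suN {P : C(GaugeConfig d L (Matrix.specialUnitaryGroup (Fin N) ℂ), ℝ)}
    (hP : P ∈ polyAlgebra (ι := Edge d L) (fundamentalLatticeRep N)) {ε : ℝ} (hε : 0 < ε) :
    ∀ᶠ n in atTop, giRpCutLevelValuesSuN N β Θ S n P ⊆
      Set.Icc (∫ U, P U ∂(wilsonMeasure (fundamentalRep (Fin N)) β) - ε)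
        (∫ U, P U ∂(wilsonMeasure (fundamentalRep (Fin N)) β) + ε) := by
  filter_upwards [levelValues_subset_Icc_suN N β hP hε] with n hn
  exact (giRpCutLevelValues_subset_levelValues n P).trans hn

/-- ★★★ **If the Wilson measure is RP on gauge-invariant observables for `(Θ, S)` (and `Θ` is
polynomial-stable), EVERY solution of the untruncated bootstrap satisfies every gauge-invariant cut.**
[folklore] -/
theorem giRpCut_of_bootstrap_suN
    (hRP : GIReflectionPositiveOn (wilsonMeasure (d := d) (L := L) (fundamentalRep (Fin N)) β) Θ S)
    (hΘpoly : ∀ f ∈ polyAlgebra (ι := Edge d L) (fundamentalLatticeRep N),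
      f.comp Θ ∈ polyAlgebra (ι := Edge d L) (fundamentalLatticeRep N))
    {φ : C(GaugeConfig d L (Matrix.specialUnitaryGroup (Fin N) ℂ), ℝ) →ₗ[ℝ] ℝ} (h1 : φ 1 = 1)
    (hpos : ∀ a ∈ polyAlgebra (ι := Edge d L) (fundamentalLatticeRep N), 0 ≤ φ (a * a))
    (hφ : IsSDFunctional (fundamentalLatticeRep N) (suExp N) (fun _ => wilsonAction (fundamentalRep (Fin N))) β φ)
    {f : C(GaugeConfig d L (Matrix.specialUnitaryGroup (Fin N) ℂ), ℝ)}
    (hf : f ∈ polyAlgebra (ι := Edge d L) (fundamentalLatticeRep N)) (hfG : IsGaugeInvariant (⇑f))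
    (hfS : DependsOn (⇑f) S) :
    0 ≤ φ (f.comp Θ * f) := by
  rw [eq_wilson_of_bootstrap_suN N β h1 hpos hφ (Subalgebra.mul_mem _ (hΘpoly f hf) hf)]
  have h := hRP.real f hfG hfS
  simpa only [ContinuousMap.mul_apply, ContinuousMap.comp_apply] using h

/-- ★★ **Soundness**: GI-RP ⇒ the Wilson value satisfies the gauge-invariant cuts at every level. -/
theorem wilson_mem_giRpCutLevelValues_suN
    (hRP : GIReflectionPositiveOn (wilsonMeasure (d := d) (L := L) (fundamentalRep (Fin N)) β) Θ S) (n : ℕ)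
    (P : C(GaugeConfig d L (Matrix.specialUnitaryGroup (Fin N) ℂ), ℝ)) :
    ∫ U, P U ∂(wilsonMeasure (fundamentalRep (Fin N)) β) ∈ giRpCutLevelValuesSuN N β Θ S n P := by
  haveI : IsProbabilityMeasure (wilsonMeasure (d := d) (L := L) (fundamentalRep (Fin N)) β) :=
    isProbabilityMeasure_wilsonMeasure (ρ := fundamentalRep (Fin N)) (continuous_fundamentalRep _) β
  refine ⟨expectationFunctional (wilsonMeasure (fundamentalRep (Fin N)) β),
    isBootstrapFeasible_wilson_suN N β _ rfl (wordTruncation_subset_polyAlgebra _ n),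
    fun v _ hvS hvG => ?_, rfl⟩
  rw [expectationFunctional_apply]
  have h := hRP.real v hvG hvS
  simpa only [ContinuousMap.mul_apply, ContinuousMap.comp_apply] using h

/-- ★★★ **Not GI-RP ⇒ every solution violates a gauge-invariant cut** (`Θ` a `μ_Wilson`-preserving
polynomial-stable involution; the Wilson measure is gauge invariant,
`wilsonMeasure_map_gaugeTransform_holds`). [folklore] -/
theorem exists_giRpCut_neg_of_bootstrap_suN
    (hΘμ : MeasurePreserving Θ (wilsonMeasure (d := d) (L := L) (fundamentalRep (Fin N)) β)
      (wilsonMeasure (fundamentalRep (Fin N)) β))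
    (hΘΘ : ∀ U, Θ (Θ U) = U)
    (hΘpoly : ∀ f ∈ polyAlgebra (ι := Edge d L) (fundamentalLatticeRep N),
      f.comp Θ ∈ polyAlgebra (ι := Edge d L) (fundamentalLatticeRep N))
    (hRP : ¬ GIReflectionPositiveOn (wilsonMeasure (d := d) (L := L) (fundamentalRep (Fin N)) β) Θ S)
    {φ : C(GaugeConfig d L (Matrix.specialUnitaryGroup (Fin N) ℂ), ℝ) →ₗ[ℝ] ℝ} (h1 : φ 1 = 1)
    (hpos : ∀ a ∈ polyAlgebra (ι := Edge d L) (fundamentalLatticeRep N), 0 ≤ φ (a * a))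
    (hφ : IsSDFunctional (fundamentalLatticeRep N) (suExp N) (fun _ => wilsonAction (fundamentalRep (Fin N))) β φ) :
    ∃ f ∈ polyAlgebra (ι := Edge d L) (fundamentalLatticeRep N), IsGaugeInvariant (⇑f) ∧ DependsOn (⇑f) S ∧
      φ (f.comp Θ * f) < 0 := by
  haveI : IsProbabilityMeasure (wilsonMeasure (d := d) (L := L) (fundamentalRep (Fin N)) β) :=
    isProbabilityMeasure_wilsonMeasure (ρ := fundamentalRep (Fin N)) (continuous_fundamentalRep _) β
  have hRP' : ¬ GIReflectionPositiveOn (wilsonMeasure (d := d) (L := L) (fundamentalLatticeRep N).ρ β) Θ S := hRP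
  obtain ⟨f, hf, hfG, hfS, hneg⟩ := exists_giPoly_neg_of_not_giReflectionPositiveOn (fundamentalLatticeRep N) _
    (fun g => wilsonMeasure_map_gaugeTransform_holds (d := d) (L := L) _ β g) hΘμ hΘΘ hRP'
  refine ⟨f, hf, hfG, hfS, ?_⟩
  rw [eq_wilson_of_bootstrap_suN N β h1 hpos hφ (Subalgebra.mul_mem _ (hΘpoly f hf) hf)]
  have hneg' : ∫ U, f (Θ U) * f U ∂(wilsonMeasure (fundamentalRep (Fin N)) β) < 0 := hneg
  simpa only [ContinuousMap.mul_apply, ContinuousMap.comp_apply] using hneg'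

/-- ★★★ **Not GI-RP ⇒ the gauge-invariant cut SDP is INFEASIBLE at all large levels, for every
objective.** [folklore] -/
theorem giRpCutLevelValues_eventually_eq_empty_suN
    (hΘμ : MeasurePreserving Θ (wilsonMeasure (d := d) (L := L) (fundamentalRep (Fin N)) β)
      (wilsonMeasure (fundamentalRep (Fin N)) β))
    (hΘΘ : ∀ U, Θ (Θ U) = U)
    (hΘpoly : ∀ f ∈ polyAlgebra (ι := Edge d L) (fundamentalLatticeRep N),
      f.comp Θ ∈ polyAlgebra (ι := Edge d L) (fundamentalLatticeRep N))
    (hRP : ¬ GIReflectionPositiveOn (wilsonMeasure (d := d) (L := L) (fundamentalRep (Fin N)) β) Θ S)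
    (P : C(GaugeConfig d L (Matrix.specialUnitaryGroup (Fin N) ℂ), ℝ)) :
    ∀ᶠ n in atTop, giRpCutLevelValuesSuN N β Θ S n P = ∅ := by
  haveI : IsProbabilityMeasure (wilsonMeasure (d := d) (L := L) (fundamentalRep (Fin N)) β) :=
    isProbabilityMeasure_wilsonMeasure (ρ := fundamentalRep (Fin N)) (continuous_fundamentalRep _) β
  have hRP' : ¬ GIReflectionPositiveOn (wilsonMeasure (d := d) (L := L) (fundamentalLatticeRep N).ρ β) Θ S := hRP
  obtain ⟨f, hf, hfG, hfS, hneg⟩ := exists_giPoly_neg_of_not_giReflectionPositiveOn (fundamentalLatticeRep N) _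
    (fun g => wilsonMeasure_map_gaugeTransform_holds (d := d) (L := L) _ β g) hΘμ hΘΘ hRP'
  have hneg' : ∫ U, f (Θ U) * f U ∂(wilsonMeasure (fundamentalRep (Fin N)) β) < 0 := hneg
  have hQ : f.comp Θ * f ∈ polyAlgebra (ι := Edge d L) (fundamentalLatticeRep N) :=
    Subalgebra.mul_mem _ (hΘpoly f hf) hf
  have hW : ∫ U, (f.comp Θ * f) U ∂(wilsonMeasure (fundamentalRep (Fin N)) β) < 0 := by
    simpa only [ContinuousMap.mul_apply, ContinuousMap.comp_apply] using hneg'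
  filter_upwards [eventually_mem_wordTruncation (fundamentalLatticeRep N) hf,
    bootstrap_convergence_words_suN (d := d) (L := L) N β hQ
      (ε := -(∫ U, (f.comp Θ * f) U ∂(wilsonMeasure (fundamentalRep (Fin N)) β)) / 2)
      (by linarith)] with n hfn hconv
  refine Set.eq_empty_iff_forall_notMem.2 fun t ⟨φ, hφ, hcut, _⟩ => ?_
  have h0 := hcut f hfn hfS hfG
  have h2 := (abs_le.1 (hconv φ hφ)).2
  linarith

/-- ★★★ **CONSISTENT IFF REFLECTION POSITIVE ON GAUGE-INVARIANT OBSERVABLES** (`SU(N)` on `(ℤ/L)^d`,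
any real `β`, `Θ` a continuous `μ_Wilson`-preserving polynomial-stable involution, `S` any link set).
[folklore] -/
theorem giRpCuts_sound_iff_suN
    (hΘμ : MeasurePreserving Θ (wilsonMeasure (d := d) (L := L) (fundamentalRep (Fin N)) β)
      (wilsonMeasure (fundamentalRep (Fin N)) β))
    (hΘΘ : ∀ U, Θ (Θ U) = U)
    (hΘpoly : ∀ f ∈ polyAlgebra (ι := Edge d L) (fundamentalLatticeRep N),
      f.comp Θ ∈ polyAlgebra (ι := Edge d L) (fundamentalLatticeRep N)) :
    GIReflectionPositiveOn (wilsonMeasure (d := d) (L := L) (fundamentalRep (Fin N)) β) Θ S ↔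
      ∀ (n : ℕ) (P : C(GaugeConfig d L (Matrix.specialUnitaryGroup (Fin N) ℂ), ℝ)),
        ∫ U, P U ∂(wilsonMeasure (fundamentalRep (Fin N)) β) ∈ giRpCutLevelValuesSuN N β Θ S n P := by
  refine ⟨fun h n P => wilson_mem_giRpCutLevelValues_suN h n P, fun h => ?_⟩
  by_contra hRP
  obtain ⟨n, hn⟩ := (giRpCutLevelValues_eventually_eq_empty_suN hΘμ hΘΘ hΘpoly hRP 1).exists
  have hmem := h n 1
  rw [hn] at hmem
  exact hmem

/-- ★★★ **The dichotomy on Wilson-loop data**: sound at every level for every observable, or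
eventually infeasible for every observable. [folklore] -/
theorem giRpCuts_dichotomy_suN
    (hΘμ : MeasurePreserving Θ (wilsonMeasure (d := d) (L := L) (fundamentalRep (Fin N)) β)
      (wilsonMeasure (fundamentalRep (Fin N)) β))
    (hΘΘ : ∀ U, Θ (Θ U) = U)
    (hΘpoly : ∀ f ∈ polyAlgebra (ι := Edge d L) (fundamentalLatticeRep N),
      f.comp Θ ∈ polyAlgebra (ι := Edge d L) (fundamentalLatticeRep N)) :
    (∀ (n : ℕ) (P : C(GaugeConfig d L (Matrix.specialUnitaryGroup (Fin N) ℂ), ℝ)),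
        ∫ U, P U ∂(wilsonMeasure (fundamentalRep (Fin N)) β) ∈ giRpCutLevelValuesSuN N β Θ S n P) ∨
      ∀ P : C(GaugeConfig d L (Matrix.specialUnitaryGroup (Fin N) ℂ), ℝ),
        ∀ᶠ n in atTop, giRpCutLevelValuesSuN N β Θ S n P = ∅ := by
  by_cases hRP : GIReflectionPositiveOn (wilsonMeasure (d := d) (L := L) (fundamentalRep (Fin N)) β) Θ S
  · exact Or.inl ((giRpCuts_sound_iff_suN hΘμ hΘΘ hΘpoly).1 hRP)
  · exact Or.inr fun P => giRpCutLevelValues_eventually_eq_empty_suN hΘμ hΘΘ hΘpoly hRP P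

/-! ## The diagonal family on Wilson-loop data -/

variable (N β)

/-- ★★★ **The cell's gauge-invariant diagonal cuts are consistent with the `SU(N)` torus bootstrap
IFF `GaugeInvariantDiagonalRP (fundamentalRep (Fin N)) β i j`** (any torus, any real `β`, any mirror);
otherwise the feasible sets `diagRpLevelValuesSuN` are EMPTY at all large levels
(`giDiagRpLevelValues_eventually_eq_empty_suN`). [folklore] -/
theorem giDiagCuts_sound_iff_suN (i j : Fin d) :
    GaugeInvariantDiagonalRP (d := d) (L := L) (fundamentalRep (Fin N)) β i j ↔
      ∀ (n : ℕ) (P : C(GaugeConfig d L (Matrix.specialUnitaryGroup (Fin N) ℂ), ℝ)),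
        ∫ U, P U ∂(wilsonMeasure (fundamentalRep (Fin N)) β) ∈
          diagRpLevelValuesSuN (d := d) (L := L) N β i j n P := by
  rw [← giReflectionPositiveOn_configDiagSwap_iff]
  simp only [diagRpLevelValuesSuN_eq]
  exact giRpCuts_sound_iff_suN
    (measurePreserving_configDiagSwap_wilson (fundamentalRep (Fin N)) (continuous_fundamentalRep _) β i j)
    (configDiagSwap_configDiagSwap i j) (fun _ hg => comp_diagSwapCM_mem_polyAlgebra _ i j hg)

/-- ★★★ **Inconsistency on Wilson-loop data**: `¬ GaugeInvariantDiagonalRP ⇒` the gauge-invariant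
diagonal cut SDP is eventually infeasible for every objective. [folklore] -/
theorem giDiagRpLevelValues_eventually_eq_empty_suN {i j : Fin d}
    (hRP : ¬ GaugeInvariantDiagonalRP (d := d) (L := L) (fundamentalRep (Fin N)) β i j)
    (P : C(GaugeConfig d L (Matrix.specialUnitaryGroup (Fin N) ℂ), ℝ)) :
    ∀ᶠ n in atTop, diagRpLevelValuesSuN (d := d) (L := L) N β i j n P = ∅ := by
  rw [← giReflectionPositiveOn_configDiagSwap_iff] at hRP
  simp only [diagRpLevelValuesSuN_eq]
  exact giRpCutLevelValues_eventually_eq_empty_suN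
    (measurePreserving_configDiagSwap_wilson (fundamentalRep (Fin N)) (continuous_fundamentalRep _) β i j)
    (configDiagSwap_configDiagSwap i j) (fun _ hg => comp_diagSwapCM_mem_polyAlgebra _ i j hg) hRP P

/-- ★★★ **The completed two-dimensional table on Wilson-loop data** (`(ℤ/L)²`, `L ≥ 2`, `L ≠ 3`,
`SU(N)` with `N ≥ 2`, `i ≠ j`, any real `β`; `DiagRPTwo.gaugeInvariantDiagonalRP_two_iff_suN_master`):
the gauge-invariant diagonal cuts are consistent with the bootstrap iff
`(Even L ∧ 4 ≤ L) ∨ (Odd L ∧ 0 ≤ β)`. [folklore] -/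
theorem giDiagCuts_two_iff_suN (h2 : 2 ≤ L) (h3 : L ≠ 3) (hN : 2 ≤ N) {i j : Fin 2} (hij : i ≠ j) :
    (∀ (n : ℕ) (P : C(GaugeConfig 2 L (Matrix.specialUnitaryGroup (Fin N) ℂ), ℝ)),
        ∫ U, P U ∂(wilsonMeasure (fundamentalRep (Fin N)) β) ∈
          diagRpLevelValuesSuN (d := 2) (L := L) N β i j n P) ↔ (Even L ∧ 4 ≤ L) ∨ (Odd L ∧ 0 ≤ β) := by
  rw [← giDiagCuts_sound_iff_suN N β i j]
  exact DiagRPTwo.gaugeInvariantDiagonalRP_two_iff_suN_master h2 h3 hN β hij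

/-- ★★★ **Odd two-tori at negative coupling** (`(ℤ/L)²`, `L ≥ 5` odd, `N ≥ 2`, `β < 0`): even on
Wilson-loop data the diagonal cuts are eventually INFEASIBLE for every objective. [folklore] -/
theorem giDiagCuts_two_odd_neg_eventually_eq_empty_suN (hLo : Odd L) (h5 : 5 ≤ L) (hN : 2 ≤ N)
    {i j : Fin 2} (hij : i ≠ j) (hβ : β < 0)
    (P : C(GaugeConfig 2 L (Matrix.specialUnitaryGroup (Fin N) ℂ), ℝ)) :
    ∀ᶠ n in atTop, diagRpLevelValuesSuN (d := 2) (L := L) N β i j n P = ∅ := by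
  refine giDiagRpLevelValues_eventually_eq_empty_suN N β (fun h => ?_) P
  have h' := (DiagRPTwo.gaugeInvariantDiagonalRP_two_iff_suN_master (by omega) (by omega) hN β hij).1 h
  rcases h' with ⟨hE, -⟩ | ⟨-, hβ0⟩
  · exact (Nat.not_even_iff_odd.2 hLo) hE
  · exact absurd hβ0 (not_le.2 hβ)

end Unitary

end Summit.QuantumFields.GaugeBoot

end
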